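import Literature.IUT.HodgeTheaters.PuncturedEllipticCoveringsCor12OfOriginLaws
import HarnessLib

/-!
# [IUTchI] Cor. 1.2 over the origin laws — abc-iut-L5-t1's record `ModLCuspLaws` OPENED into its fields, with
# (L0) discharged from (A) and (L1) from (c) — proof-only knit (row R23 «COR12-MODL-CUSPLAWS-KNIT»)

Mochizuki, *Inter-universal Teichmüller theory I*, kurims manuscript (May 2020), §1, pp. 37–39 — the
`Δ_ε`-level sentences of p. 37 l. 30 – p. 38 l. 24 and Corollary 1.2 p. 39 ([IUTchI] §1 pp.37–39)
[claim: Mochizuki2012, status: disputed]; classical input [AbsTopI] Lemma 4.5 (i) p. 54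
[cite: MochizukiAbsTopI2012, Lemma 4.5 (i) p.54].  Node `IUTchI:Cor1.2` (plan/L5/SUBDAG-IUTchI-Cor12.md; L5 ROWS #6
row R23); cell abc-iut, seat abc-iut-f-090 (gen 8).  PROOF-ONLY companion (no definitions, no instances, no
notation, nothing restated) over abc-iut-L5-t1's `…Cor12OfOriginLaws.lean` (p494944, closer
`InitialThetaData.pe_characteristicNatureOfCoverings_of_originLaws`), abc-iut-L5-t1's record
`PuncturedEllipticData.ModLCuspLaws` (p446054: six `Prop` fields (L0) (L1) (L2a) (L2c) (L3) (L4)), and this seat's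
`modLKer_relIndex_ne_zero_of_isFreeProOn` (p494126, (L0) from (A)) / `inertia_procyclic_of_commutatorCusp` (p491462,
(L1) from (c)).

WHAT THIS FILE DOES.  (§1) `PuncturedEllipticData.modLCuspLaws_of_freePro_commutatorCusp`: the record
`D.ModLCuspLaws` ASSEMBLED from the origin data (A) `IsFreeProOn ↥Δ_X Set.univ gens` and (c) "every cusp inertia
group of `X̲` is `⟨g [gens 0, gens 1] g⁻¹⟩⁻`, `g ∈ Δ_X`" — which give (L0) "`Δ_X̲^{ab} ⊗ ℤ/l` finite" and (L1) "cusp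
inertia procyclic" — together with the FOUR remaining printed `Δ_ε`-level sentences displayed VERBATIM as the
field types of `ModLCuspLaws`: (L2a) "`I_ε′ ≅ ℤ/lℤ`" in `Δ_ε`, (L2c) "`0 → I_ε′ × I_ε″ → Δ_ε`", (L3) "`ι` acts on
`Δ_E ⊗ ℤ/l` by `−1`", (L4) "`G_k` acts trivially on `Δ_ε⁺`" (p. 37 l. 34 – p. 38 l. 24).  (§2)
`InitialThetaData.pe_characteristicNatureOfCoverings_of_originLaws_modLFields`: abc-iut-L5-t1's closer p494944 with
its two structure binders `hL : D.geom.pe.ModLCuspLaws`, `L′ : D′.geom.pe.ModLCuspLaws` OPENED — (L0), (L1)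
discharged at both data from (A), (c), the eight sentences (L2a) (L2c) (L3) (L4) × 2 displayed.  Displayed binders
of the result: DATA `C C′ A`; ORIGIN `hfree hfree′` (A), `hcusp hcusp′` (c) (GAP G-L5t1g11-1 and G-L5t1g11-2 shapes, now at
BOTH data), `hgenC′` (G-L5t1g11-3); FACT `hA hA′` (F-0206); GAP `h0 h0′` (G-L5d4g6-1); LAW `hext hextC` ([AbsTopII]
Cor. 3.3 (i) extension form, row R7) and the printed `Δ_ε`-sentences `hL2a hL2c hL3 hL4 hL2a′ hL2c′ hL3′ hL4′`
(record-law content 12 fields → 8; deriving these four from a mod-`l` homology origin datum is the separate row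
«COR12-MODL-HOMOLOGY-DATUM», pending the lead's ruling (α)).

HONEST FRAMING: nothing here asserts that abc is proved or refuted or takes a side on [IUTchIII] Cor. 3.12;
every binder is an assumption label quoting print or a classical origin datum, never asserted; opening a record
into its fields is bookkeeping, not a discharge; typed ≠ inhabited ≠ discharged; no printed statement is
strengthened.
-/

namespace Literature.IUT.HodgeTheaters

namespace PuncturedEllipticData

open Literature.AnabelianGeometry.AbsoluteAnabelian

universe u

variable (D : PuncturedEllipticData.{u})

/-- **abc-iut-L5-t1's record `ModLCuspLaws` assembled from the origin data (A) + (c) and the four remaining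
printed `Δ_ε`-level sentences.**  (L0) "`Δ_X̲^{ab} ⊗ (ℤ/lℤ)` finite" is `modLKer_relIndex_ne_zero_of_isFreeProOn hfree`
(`Δ_X` free profinite of finite rank, [AbsTopI] Lem. 4.5 (i)); (L1) "cusp inertia procyclic" is
`inertia_procyclic_of_commutatorCusp hcusp` (cusp inertia `⟨g [a, b] g⁻¹⟩⁻`); (L2a) (L2c) (L3) (L4) are the displayed
hypotheses, VERBATIM the field types of `ModLCuspLaws` ("`0 → I_ε′ × I_ε″ → Δ_ε → Δ_E ⊗ (ℤ/lℤ) → 0` … `I_ε′ ≅ ℤ/lℤ`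
… `ι` acts on `Δ_E ⊗ (ℤ/lℤ)` via multiplication by `−1` … the natural [outer] action of `G_k` on `Δ_ε⁺ …` is
trivial", p. 37 l. 34 – p. 38 l. 24). ([IUTchI] §1 pp.37–38) [claim: Mochizuki2012, status: disputed] -/
theorem modLCuspLaws_of_freePro_commutatorCusp {gens : Fin 2 → ↥(D.PiX ⊓ D.DeltaC)}
    (hfree : IsFreeProOn ↥(D.PiX ⊓ D.DeltaC) Set.univ gens)
    (hcusp : ∀ x : D.Cusp, ∃ g ∈ D.PiX ⊓ D.DeltaC,
      D.inertia x = (Subgroup.zpowers (g * ((gens 0 : D.PiC) * (gens 1 : D.PiC) *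
        (gens 0 : D.PiC)⁻¹ * (gens 1 : D.PiC)⁻¹) * g⁻¹)).topologicalClosure)
    (hL2a : D.deltaEpsKer.relIndex (D.inertia D.ε1 ⊔ D.deltaEpsKer) = D.l)
    (hL2c : D.inertia D.ε1 ⊓ (D.inertia D.ε2 ⊔ D.deltaEpsKer) ≤ D.deltaEpsKer)
    (hL3 : ∀ c ∈ D.DeltaCbar, c ∉ D.DeltaXbar → ∀ v ∈ D.DeltaXbar,
      c * v * c⁻¹ * v ∈ D.inertia D.ε1 ⊔ D.inertia D.ε2 ⊔ D.deltaEpsKer)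
    (hL4 : ∀ x : D.Cusp, ∀ g ∈ D.PiXbar, ∀ z ∈ D.inertia x, g * z * g⁻¹ * z⁻¹ ∈ D.modLKer) :
    D.ModLCuspLaws :=
  ⟨D.modLKer_relIndex_ne_zero_of_isFreeProOn hfree, D.inertia_procyclic_of_commutatorCusp hcusp,
    hL2a, hL2c, hL3, hL4⟩

end PuncturedEllipticData

namespace InitialThetaData

open scoped Pointwise
open Literature.AnabelianGeometry.AbsoluteAnabelian
open Literature.AnabelianGeometry.AbsoluteAnabelian.FundamentalExtension (CuspidalAlgorithm)

universe u u'

variable {F : Type u} {K : Type} {Fbar : Type} [Field F] [NumberField F] [Field K] [NumberField K]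
  [Algebra F K] [Field Fbar] [Algebra F Fbar] [Algebra K Fbar]
  {E : WeierstrassCurve F} [E.IsElliptic] {l : ℕ} {Pb : BadPlacePredicates K}
  (D : InitialThetaData F K Fbar E l Pb)
  {F' : Type u'} {K' : Type} [Field F'] [NumberField F'] [Field K'] [NumberField K'] [Algebra F' K']
  {Fbar' : Type} [Field Fbar'] [Algebra F' Fbar'] [Algebra K' Fbar']
  {E' : WeierstrassCurve F'} [E'.IsElliptic] {l' : ℕ} {Pb' : BadPlacePredicates K'}
  (D' : InitialThetaData F' K' Fbar' E' l' Pb')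

/-- **[IUTchI] Cor. 1.2 between the `K`-level data of two initial Θ-data, over the ORIGIN LAWS (A), (c), (e),
with abc-iut-L5-t1's record binders `hL`, `L′` (`ModLCuspLaws`) OPENED into their printed fields** — row R23
«COR12-MODL-CUSPLAWS-KNIT»: abc-iut-L5-t1's `pe_characteristicNatureOfCoverings_of_originLaws` (p494944) with
`hL := modLCuspLaws_of_freePro_commutatorCusp hfree hcusp hL2a hL2c hL3 hL4` and likewise `L′` at the primed datum:
(L0) "`Δ_X̲^{ab} ⊗ ℤ/l` finite" and (L1) "cusp inertia procyclic" are DISCHARGED at both data from (A) + (c); the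
`Δ_ε`-level sentences (L2a) (L2c) (L3) (L4) of p. 37 l. 34 – p. 38 l. 24 stay displayed, verbatim, at both data.
Displayed binders: DATA `C C′ A`; ORIGIN `hfree hfree′` (A), `hcusp hcusp′` (c), `hgenC′` (e); FACT `hA hA′` (F-0206);
GAP `h0 h0′` (G-L5d4g6-1); LAW `hext hextC` ([AbsTopII] Cor. 3.3 (i) extension form) and `hL2a hL2c hL3 hL4`,
`hL2a′ hL2c′ hL3′ hL4′`. ([IUTchI] Cor 1.2 p.39) [claim: Mochizuki2012, status: disputed] -/
theorem pe_characteristicNatureOfCoverings_of_originLaws_modLFields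
    (C : D.geom.pe.CuspGalois) (C' : D'.geom.pe.CuspGalois)
    {gens : Fin 2 → ↥(D.geom.pe.PiX ⊓ D.geom.pe.DeltaC)}
    (hfree : IsFreeProOn ↥(D.geom.pe.PiX ⊓ D.geom.pe.DeltaC) Set.univ gens)
    {gens' : Fin 2 → ↥(D'.geom.pe.PiX ⊓ D'.geom.pe.DeltaC)}
    (hfree' : IsFreeProOn ↥(D'.geom.pe.PiX ⊓ D'.geom.pe.DeltaC) Set.univ gens')
    (hcusp : ∀ x : D.geom.pe.Cusp, ∃ g ∈ D.geom.pe.PiX ⊓ D.geom.pe.DeltaC,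
      D.geom.pe.inertia x = (Subgroup.zpowers (g * ((gens 0 : D.geom.pe.PiC) * (gens 1 : D.geom.pe.PiC) *
        (gens 0 : D.geom.pe.PiC)⁻¹ * (gens 1 : D.geom.pe.PiC)⁻¹) * g⁻¹)).topologicalClosure)
    (hcusp' : ∀ x : D'.geom.pe.Cusp, ∃ g ∈ D'.geom.pe.PiX ⊓ D'.geom.pe.DeltaC,
      D'.geom.pe.inertia x = (Subgroup.zpowers (g * ((gens' 0 : D'.geom.pe.PiC) * (gens' 1 : D'.geom.pe.PiC) *
        (gens' 0 : D'.geom.pe.PiC)⁻¹ * (gens' 1 : D'.geom.pe.PiC)⁻¹) * g⁻¹)).topologicalClosure)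
    (hgenC' : D'.geom.pe.DeltaC ≤ (Subgroup.closure
      {g : D'.geom.pe.PiC | g ∈ D'.geom.pe.DeltaC ∧ IsOfFinOrder g}).topologicalClosure)
    -- the four Δ_ε-level sentences of p. 37–38 at the unprimed datum ((L2a) (L2c) (L3) (L4) of `ModLCuspLaws`)
    (hL2a : D.geom.pe.deltaEpsKer.relIndex (D.geom.pe.inertia D.geom.pe.ε1 ⊔ D.geom.pe.deltaEpsKer) = D.geom.pe.l)
    (hL2c : D.geom.pe.inertia D.geom.pe.ε1 ⊓ (D.geom.pe.inertia D.geom.pe.ε2 ⊔ D.geom.pe.deltaEpsKer) ≤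
      D.geom.pe.deltaEpsKer)
    (hL3 : ∀ c ∈ D.geom.pe.DeltaCbar, c ∉ D.geom.pe.DeltaXbar → ∀ v ∈ D.geom.pe.DeltaXbar,
      c * v * c⁻¹ * v ∈ D.geom.pe.inertia D.geom.pe.ε1 ⊔ D.geom.pe.inertia D.geom.pe.ε2 ⊔ D.geom.pe.deltaEpsKer)
    (hL4 : ∀ x : D.geom.pe.Cusp, ∀ g ∈ D.geom.pe.PiXbar, ∀ z ∈ D.geom.pe.inertia x,
      g * z * g⁻¹ * z⁻¹ ∈ D.geom.pe.modLKer)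
    -- … and at the primed datum
    (hL2a' : D'.geom.pe.deltaEpsKer.relIndex (D'.geom.pe.inertia D'.geom.pe.ε1 ⊔ D'.geom.pe.deltaEpsKer) =
      D'.geom.pe.l)
    (hL2c' : D'.geom.pe.inertia D'.geom.pe.ε1 ⊓ (D'.geom.pe.inertia D'.geom.pe.ε2 ⊔ D'.geom.pe.deltaEpsKer) ≤
      D'.geom.pe.deltaEpsKer)
    (hL3' : ∀ c ∈ D'.geom.pe.DeltaCbar, c ∉ D'.geom.pe.DeltaXbar → ∀ v ∈ D'.geom.pe.DeltaXbar,
      c * v * c⁻¹ * v ∈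
        D'.geom.pe.inertia D'.geom.pe.ε1 ⊔ D'.geom.pe.inertia D'.geom.pe.ε2 ⊔ D'.geom.pe.deltaEpsKer)
    (hL4' : ∀ x : D'.geom.pe.Cusp, ∀ g ∈ D'.geom.pe.PiXbar, ∀ z ∈ D'.geom.pe.inertia x,
      g * z * g⁻¹ * z⁻¹ ∈ D'.geom.pe.modLKer)
    (h0 : ¬ D.geom.pe.inertia D.geom.pe.ε0 ≤ D.geom.pe.piXarrow)
    (h0' : ¬ D'.geom.pe.inertia D'.geom.pe.ε0 ≤ D'.geom.pe.piXarrow)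
    (hext : ∀ φ : D.geom.pe.piXarrow ≃* D'.geom.pe.piXarrow, Continuous φ → Continuous φ.symm →
      ∃ Θ : D.geom.pe.PiC ≃ₜ* D'.geom.pe.PiC,
        ∀ x : D.geom.pe.piXarrow, Θ (x : D.geom.pe.PiC) = (φ x : D'.geom.pe.PiC))
    (hextC : ∀ ψ : D.geom.pe.piCarrow ≃* D'.geom.pe.piCarrow, Continuous ψ → Continuous ψ.symm →
      ∃ Θ : D.geom.pe.PiC ≃ₜ* D'.geom.pe.PiC,
        ∀ x : D.geom.pe.piCarrow, Θ (x : D.geom.pe.PiC) = (ψ x : D'.geom.pe.PiC))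
    (A : CuspidalAlgorithm.{0}) (hA : A.RecoversCusps D.geom.pe.extXbar C.cuspidalDataXbar)
    (hA' : A.RecoversCusps D'.geom.pe.extXbar C'.cuspidalDataXbar) :
    D.geom.pe.CharacteristicNatureOfCoverings D'.geom.pe :=
  D.pe_characteristicNatureOfCoverings_of_originLaws D' C C'
    (D.geom.pe.modLCuspLaws_of_freePro_commutatorCusp hfree hcusp hL2a hL2c hL3 hL4)
    (D'.geom.pe.modLCuspLaws_of_freePro_commutatorCusp hfree' hcusp' hL2a' hL2c' hL3' hL4')
    hfree hfree' hcusp' hgenC' h0 h0' hext hextC A hA hA'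

end InitialThetaData

end Literature.IUT.HodgeTheaters
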